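import Summits.MatrixMultiplication.OmegaCensus.STPPSmallPatternKernelBits
import Mathlib.Tactic.Ring
import Mathlib.Tactic.Linarith

/-!
# ω-census, small STPP pattern `(2,1,1)^k`: kernel search — product encodings `ZMod n₁ × H₂`

HONEST FRAMING (pub-omega census; verbatim): lottery ticket; floor = certified bounds/negative ranges.
Census STRUCTURE bookkeeping of the STPP track (seat pub-omega-stpp-3, gen 23; STRUCTURE row B5, the threshold column
`T1(H) = max {k : (2,1,1)^k ⊆ H}` — its LOWER sides as kernel theorems), not progress on `ω`: small patterns in small groups
bound no exponent.

The encoding `prodEnc n₁ E₂ : GEnc (ZMod n₁ × H₂)` of a product with a cyclic outer factor over an encoding `E₂` of `H₂`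
(`STPPSmallPatternKernelBits.lean`): codes `x.val · n₂ + enc₂ y` (`n₂ = E₂.g.n`), so a mask of the product is `n₁` LANES of
width `n₂`; translation by `(t₁, t₂)` = the lane-wise translation by `t₂` (`laneMap`, through `E₂.g.tr`) followed by the rotation
of the lanes by `t₁` (`rot` by `t₁ · n₂` bits); `sub`/`neg` component-wise on codes (`prodGC`).  The one-sided translation
property `tr_spec` is proved from `testBit_rot`, the lane lemma `testBit_laneMap` and `E₂.tr_spec`.  Nested, this covers every
finite abelian group `ZMod q₁ × (ZMod q₂ × ⋯)` (the census' `SeedType` lists); used by the non-cyclic cells of the `T1` table.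

References: H. Cohn, R. Kleinberg, B. Szegedy, C. Umans, FOCS 2005 (arXiv:math/0511460), Def. 5.1.  Record: pub-omega HOME
`pub-omega-stpp-3-g23/` (kernel timings: `ℤ/3 × ℤ/6`, `k = 5`: 656 310 mirror translations in 52 s; `ℤ/2 × (ℤ/3 × ℤ/3)`: 90 s).
-/

namespace Summit.MatrixMultiplication.OmegaCensus

namespace STPP211Neg

/-! ## Product encodings: `ZMod n₁ × H₂`, lanes of width `n₂` -/

section Prod

/-- `Nat.div` is `/`. -/ theorem div_eq' (a b : ℕ) : Nat.div a b = a / b := rfl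


/-- Apply the lane transformer `f` to each of the `n₁` lanes of width `w` (lane `i` = bits `i w … i w + w − 1`, read through
the lane mask `full₂ = 2^w − 1`) and reassemble (recursor form). -/
noncomputable def laneMap (n₁ w full₂ : ℕ) (f : ℕ → ℕ) (M : ℕ) : ℕ :=
  @Nat.rec (fun _ => ℕ) 0
    (fun i acc => Nat.lor acc (Nat.shiftLeft (f (Nat.land (Nat.shiftRight M (Nat.mul i w)) full₂)) (Nat.mul i w))) n₁

/-- The code arithmetic of `ZMod n₁ × H₂` over a code arithmetic `g₂` of `H₂`: codes `x.val · n₂ + code₂`, translation =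
lane-wise translation by the `H₂`-component followed by a rotation of the lanes, component-wise `sub` / `neg`. -/
noncomputable def prodGC (n₁ : ℕ) (g₂ : GC) : GC where
  n := Nat.mul n₁ g₂.n
  full := lowMask (Nat.mul n₁ g₂.n)
  tr M t := rot (Nat.mul n₁ g₂.n) (lowMask (Nat.mul n₁ g₂.n))
    (laneMap n₁ g₂.n g₂.full (fun L => g₂.tr L (Nat.mod t g₂.n)) M) (Nat.mul (Nat.div t g₂.n) g₂.n)
  sub a b := Nat.add (Nat.mul (Nat.mod (Nat.add (Nat.div a g₂.n) (Nat.sub n₁ (Nat.div b g₂.n))) n₁) g₂.n)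
    (g₂.sub (Nat.mod a g₂.n) (Nat.mod b g₂.n))
  neg a := Nat.add (Nat.mul (Nat.mod (Nat.sub n₁ (Nat.div a g₂.n)) n₁) g₂.n) (g₂.neg (Nat.mod a g₂.n))

/-- `prodGC.tr` unfolded to standard notation. -/
theorem prodGC_tr (n₁ : ℕ) (g₂ : GC) (M t : ℕ) : (prodGC n₁ g₂).tr M t =
    rot (n₁ * g₂.n) (lowMask (n₁ * g₂.n)) (laneMap n₁ g₂.n g₂.full (fun L => g₂.tr L (t % g₂.n)) M) (t / g₂.n * g₂.n) :=
  rfl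

variable {H₂ : Type} [AddCommGroup H₂]

/-- Bits of `laneMap`: if every `f`-output is `< 2^w`, bit `i w + j` (`i < n₁`, `j < w`) of `laneMap n₁ w full₂ f M` is bit `j`
of `f` applied to lane `i` of `M`. -/
theorem testBit_laneMap {w full₂ : ℕ} {f : ℕ → ℕ} (hf : ∀ L, f L < 2 ^ w) (M : ℕ) :
    ∀ n₁ i j : ℕ, i < n₁ → j < w →
      (laneMap n₁ w full₂ f M).testBit (i * w + j) = (f (Nat.land (Nat.shiftRight M (i * w)) full₂)).testBit j := by
  intro n₁
  induction n₁ with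
  | zero => intro i j hi; exact absurd hi (Nat.not_lt_zero _)
  | succ n ih =>
      intro i j hi hj
      show (Nat.lor (laneMap n w full₂ f M)
        (Nat.shiftLeft (f (Nat.land (Nat.shiftRight M (Nat.mul n w)) full₂)) (Nat.mul n w))).testBit (i * w + j) = _
      rw [lor_eq, shiftLeft_eq', mul_eq', Nat.testBit_lor, Nat.testBit_shiftLeft]
      rcases Nat.lt_succ_iff_lt_or_eq.1 hi with hlt | rfl
      · rw [ih i j hlt hj]
        -- the new lane's shifted bits vanish at positions of lane i < n
        have hpos : i * w + j < n * w := by nlinarith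
        have : decide (i * w + j ≥ n * w) = false := by simp; omega
        rw [this, Bool.false_and, Bool.or_false]
      · -- lanes below n contribute nothing at positions ≥ n w
        have hlow : (laneMap i w full₂ f M).testBit (i * w + j) = false := by
          have hlt : laneMap i w full₂ f M < 2 ^ (i * w) := by
            clear hi ih
            induction i with
            | zero => show (0 : ℕ) < _; exact Nat.two_pow_pos _
            | succ m ihm =>
                show Nat.lor (laneMap m w full₂ f M)
                  (Nat.shiftLeft (f (Nat.land (Nat.shiftRight M (Nat.mul m w)) full₂)) (Nat.mul m w)) < _
                rw [lor_eq, shiftLeft_eq', mul_eq']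
                have h1 : laneMap m w full₂ f M < 2 ^ ((m + 1) * w) :=
                  lt_of_lt_of_le ihm (Nat.pow_le_pow_right Nat.two_pos (by nlinarith))
                have h2 : f (Nat.land (Nat.shiftRight M (m * w)) full₂) <<< (m * w) < 2 ^ ((m + 1) * w) := by
                  rw [show (m + 1) * w = w + m * w by ring]
                  exact Nat.shiftLeft_lt (hf _)
                exact Nat.or_lt_two_pow h1 h2
          exact Nat.testBit_lt_two_pow (lt_of_lt_of_le hlt (Nat.pow_le_pow_right Nat.two_pos (Nat.le_add_right _ _)))
        rw [hlow, Bool.false_or]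
        have : decide (i * w + j ≥ i * w) = true := by simp
        rw [this, Bool.true_and, show i * w + j - i * w = j by omega]

/-- `laneMap` outputs are below `2 ^ (n₁ w)`. -/
theorem laneMap_lt {w full₂ : ℕ} {f : ℕ → ℕ} (hf : ∀ L, f L < 2 ^ w) (M : ℕ) :
    ∀ n₁ : ℕ, laneMap n₁ w full₂ f M < 2 ^ (n₁ * w) := by
  intro n₁
  induction n₁ with
  | zero => show (0 : ℕ) < _; exact Nat.two_pow_pos _
  | succ m ihm =>
      show Nat.lor (laneMap m w full₂ f M)
        (Nat.shiftLeft (f (Nat.land (Nat.shiftRight M (Nat.mul m w)) full₂)) (Nat.mul m w)) < _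
      rw [lor_eq, shiftLeft_eq', mul_eq']
      have h1 : laneMap m w full₂ f M < 2 ^ ((m + 1) * w) :=
        lt_of_lt_of_le ihm (Nat.pow_le_pow_right Nat.two_pos (by nlinarith))
      have h2 : f (Nat.land (Nat.shiftRight M (m * w)) full₂) <<< (m * w) < 2 ^ ((m + 1) * w) := by
        rw [show (m + 1) * w = w + m * w by ring]
        exact Nat.shiftLeft_lt (hf _)
      exact Nat.or_lt_two_pow h1 h2

/-- Lane `i` of a mask `M < 2^(n₁ w)`: its bit `enc₂ y` is bit `i w + enc₂ y` of `M`. -/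
theorem testBit_lane (E₂ : GEnc H₂) (M i : ℕ) (y : H₂) :
    (Nat.land (Nat.shiftRight M (i * E₂.g.n)) E₂.g.full).testBit (E₂.enc y) = M.testBit (i * E₂.g.n + E₂.enc y) := by
  rw [land_eq, shiftRight_eq', Nat.testBit_land, Nat.testBit_shiftRight, testBit_full, Bool.and_true]

/-- THE PRODUCT ENCODING `ZMod n₁ × H₂` (outer factor cyclic, `n₁ ≥ 1`; code `x.val · n₂ + enc₂ y`). -/
noncomputable def prodEnc (n₁ : ℕ) [NeZero n₁] (E₂ : GEnc H₂) : GEnc (ZMod n₁ × H₂) where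
  g := prodGC n₁ E₂.g
  enc x := x.1.val * E₂.g.n + E₂.enc x.2
  enc_lt x := by
    show x.1.val * E₂.g.n + E₂.enc x.2 < Nat.mul n₁ E₂.g.n
    rw [mul_eq']
    have h1 := ZMod.val_lt x.1; have h2 := E₂.enc_lt x.2
    calc x.1.val * E₂.g.n + E₂.enc x.2 < x.1.val * E₂.g.n + E₂.g.n := by omega
      _ = (x.1.val + 1) * E₂.g.n := by ring
      _ ≤ n₁ * E₂.g.n := Nat.mul_le_mul_right _ h1
  enc_inj := by
    rintro ⟨x₁, y₁⟩ ⟨x₂, y₂⟩ h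
    dsimp only at h
    have hn : 0 < E₂.g.n := lt_of_le_of_lt (Nat.zero_le _) (E₂.enc_lt y₁)
    have hy₁ := E₂.enc_lt y₁; have hy₂ := E₂.enc_lt y₂
    have hq : x₁.val = x₂.val := by
      have := congrArg (· / E₂.g.n) h
      simp only [Nat.add_comm (_ * _), Nat.add_mul_div_right _ _ hn, Nat.div_eq_of_lt hy₁, Nat.div_eq_of_lt hy₂] at this
      simpa using this
    have hr : E₂.enc y₁ = E₂.enc y₂ := by
      have := congrArg (· % E₂.g.n) h
      simp only [Nat.add_comm (_ * _), Nat.add_mul_mod_self_right, Nat.mod_eq_of_lt hy₁, Nat.mod_eq_of_lt hy₂] at this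
      exact this
    rw [Prod.mk.injEq]
    exact ⟨ZMod.val_injective n₁ hq, E₂.enc_inj hr⟩
  enc_zero := by
    show (0 : ZMod n₁).val * E₂.g.n + E₂.enc 0 = 0
    rw [ZMod.val_zero, E₂.enc_zero]; simp
  full_eq := by
    show Nat.sub (Nat.shiftLeft 1 (Nat.mul n₁ E₂.g.n)) 1 = 2 ^ (Nat.mul n₁ E₂.g.n) - 1
    rw [shiftLeft_eq', sub_eq', Nat.one_shiftLeft]
  sub_enc x y := by
    have hx := E₂.enc_lt x.2; have hy := E₂.enc_lt y.2
    have hn : 0 < E₂.g.n := lt_of_le_of_lt (Nat.zero_le _) hx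
    have e1 : (x.1.val * E₂.g.n + E₂.enc x.2) / E₂.g.n = x.1.val := by
      rw [Nat.add_comm, Nat.add_mul_div_right _ _ hn, Nat.div_eq_of_lt hx, Nat.zero_add]
    have e2 : (x.1.val * E₂.g.n + E₂.enc x.2) % E₂.g.n = E₂.enc x.2 := by
      rw [Nat.add_comm, Nat.add_mul_mod_self_right, Nat.mod_eq_of_lt hx]
    have e3 : (y.1.val * E₂.g.n + E₂.enc y.2) / E₂.g.n = y.1.val := by
      rw [Nat.add_comm, Nat.add_mul_div_right _ _ hn, Nat.div_eq_of_lt hy, Nat.zero_add]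
    have e4 : (y.1.val * E₂.g.n + E₂.enc y.2) % E₂.g.n = E₂.enc y.2 := by
      rw [Nat.add_comm, Nat.add_mul_mod_self_right, Nat.mod_eq_of_lt hy]
    have e5 : (x.1.val + (n₁ - y.1.val)) % n₁ = (x.1 - y.1).val := (zmodEnc n₁).sub_enc x.1 y.1
    show ((x.1.val * E₂.g.n + E₂.enc x.2) / E₂.g.n + (n₁ - (y.1.val * E₂.g.n + E₂.enc y.2) / E₂.g.n)) % n₁ * E₂.g.n +
      E₂.g.sub ((x.1.val * E₂.g.n + E₂.enc x.2) % E₂.g.n) ((y.1.val * E₂.g.n + E₂.enc y.2) % E₂.g.n) =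
      (x - y).1.val * E₂.g.n + E₂.enc (x - y).2
    rw [e1, e2, e3, e4, e5, E₂.sub_enc, Prod.fst_sub, Prod.snd_sub]
  neg_enc x := by
    have hx := E₂.enc_lt x.2
    have hn : 0 < E₂.g.n := lt_of_le_of_lt (Nat.zero_le _) hx
    have e1 : (x.1.val * E₂.g.n + E₂.enc x.2) / E₂.g.n = x.1.val := by
      rw [Nat.add_comm, Nat.add_mul_div_right _ _ hn, Nat.div_eq_of_lt hx, Nat.zero_add]
    have e2 : (x.1.val * E₂.g.n + E₂.enc x.2) % E₂.g.n = E₂.enc x.2 := by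
      rw [Nat.add_comm, Nat.add_mul_mod_self_right, Nat.mod_eq_of_lt hx]
    have e5 : (n₁ - x.1.val) % n₁ = (-x.1).val := (zmodEnc n₁).neg_enc x.1
    show (n₁ - (x.1.val * E₂.g.n + E₂.enc x.2) / E₂.g.n) % n₁ * E₂.g.n + E₂.g.neg ((x.1.val * E₂.g.n + E₂.enc x.2) % E₂.g.n) =
      (-x).1.val * E₂.g.n + E₂.enc (-x).2
    rw [e1, e2, e5, E₂.neg_enc, Prod.fst_neg, Prod.snd_neg]
  tr_lt M t := by
    show Nat.land _ (lowMask (Nat.mul n₁ E₂.g.n)) < 2 ^ Nat.mul n₁ E₂.g.n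
    rw [land_eq]
    refine Nat.and_lt_two_pow _ ?_
    show Nat.sub (Nat.shiftLeft 1 _) 1 < _
    rw [shiftLeft_eq', sub_eq', Nat.one_shiftLeft]; exact Nat.sub_lt (Nat.two_pow_pos _) Nat.one_pos
  tr_spec M t z hM hz := by
    have ht2 := E₂.enc_lt t.2; have hz2 := E₂.enc_lt z.2
    have hn : 0 < E₂.g.n := lt_of_le_of_lt (Nat.zero_le _) ht2
    have ht1 := ZMod.val_lt t.1; have hz1 := ZMod.val_lt z.1
    have hdiv : (t.1.val * E₂.g.n + E₂.enc t.2) / E₂.g.n = t.1.val := by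
      rw [Nat.add_comm, Nat.add_mul_div_right _ _ hn, Nat.div_eq_of_lt ht2, Nat.zero_add]
    have hmod : (t.1.val * E₂.g.n + E₂.enc t.2) % E₂.g.n = E₂.enc t.2 := by
      rw [Nat.add_comm, Nat.add_mul_mod_self_right, Nat.mod_eq_of_lt ht2]
    have hM' : M < 2 ^ (n₁ * E₂.g.n) := hM
    have hz' : (rot (n₁ * E₂.g.n) (lowMask (n₁ * E₂.g.n))
        (laneMap n₁ E₂.g.n E₂.g.full (fun L => E₂.g.tr L (E₂.enc t.2)) M) (t.1.val * E₂.g.n)).testBit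
        (z.1.val * E₂.g.n + E₂.enc z.2) = true := by
      have h := hz
      change ((prodGC n₁ E₂.g).tr M (t.1.val * E₂.g.n + E₂.enc t.2)).testBit (z.1.val * E₂.g.n + E₂.enc z.2) = true at h
      rw [prodGC_tr, hmod, hdiv] at h
      exact h
    set N := n₁ * E₂.g.n with hN
    set LM := laneMap n₁ E₂.g.n E₂.g.full (fun L => E₂.g.tr L (E₂.enc t.2)) M with hLM
    have hLMlt : LM < 2 ^ N := by rw [hLM, hN]; exact laneMap_lt (fun L => E₂.tr_lt L _) M n₁
    have hzlt : z.1.val * E₂.g.n + E₂.enc z.2 < N := by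
      have h1 : (z.1.val + 1) * E₂.g.n ≤ n₁ * E₂.g.n := Nat.mul_le_mul_right _ hz1
      rw [Nat.succ_mul] at h1; rw [hN]; omega
    have htle : t.1.val * E₂.g.n ≤ N := Nat.mul_le_mul_right _ (le_of_lt ht1)
    rw [testBit_rot hLMlt htle hzlt] at hz'
    -- the source position inside LM: lane i, offset enc₂ z.2
    have hsrc : ∃ i, i < n₁ ∧ LM.testBit (i * E₂.g.n + E₂.enc z.2) = true ∧ (i + t.1.val) % n₁ = z.1.val := by
      by_cases hc : t.1.val * E₂.g.n ≤ z.1.val * E₂.g.n + E₂.enc z.2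
      · rw [if_pos hc] at hz'
        have hle : t.1.val ≤ z.1.val := by
          by_contra hlt
          have h1 : (z.1.val + 1) * E₂.g.n ≤ t.1.val * E₂.g.n := Nat.mul_le_mul_right _ (Nat.lt_of_not_le hlt)
          rw [Nat.succ_mul] at h1; omega
        refine ⟨z.1.val - t.1.val, by omega, ?_, by rw [Nat.sub_add_cancel hle, Nat.mod_eq_of_lt hz1]⟩
        have hmul := Nat.mul_le_mul_right E₂.g.n hle
        rw [Nat.sub_mul, ← Nat.sub_add_comm hmul]
        exact hz'
      · rw [if_neg hc] at hz'
        have hlt : z.1.val < t.1.val := by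
          by_contra hge
          exact hc (le_trans (Nat.mul_le_mul_right _ (Nat.le_of_not_lt hge)) (Nat.le_add_right _ _))
        refine ⟨z.1.val + (n₁ - t.1.val), by omega, ?_, by
          rw [show z.1.val + (n₁ - t.1.val) + t.1.val = z.1.val + n₁ by omega, Nat.add_mod_right, Nat.mod_eq_of_lt hz1]⟩
        rw [Nat.add_mul, Nat.sub_mul, ← hN]
        have hmul : t.1.val * E₂.g.n ≤ N := htle
        rw [show z.1.val * E₂.g.n + (N - t.1.val * E₂.g.n) + E₂.enc z.2 = z.1.val * E₂.g.n + E₂.enc z.2 + (N - t.1.val * E₂.g.n)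
          by omega]
        exact hz'
    obtain ⟨i, hin, hbit, hsum⟩ := hsrc
    rw [hLM, testBit_laneMap (fun L => E₂.tr_lt L _) M n₁ i (E₂.enc z.2) hin hz2] at hbit
    -- lane i of M, translated by t.2 in H₂: pull back through E₂.tr_spec
    have hlane : Nat.land (Nat.shiftRight M (i * E₂.g.n)) E₂.g.full < 2 ^ E₂.g.n := by
      rw [land_eq, E₂.full_eq]; exact Nat.and_lt_two_pow _ (Nat.sub_lt (Nat.two_pow_pos _) Nat.one_pos)
    obtain ⟨y₀, hy₀, hzy⟩ := E₂.tr_spec _ t.2 z.2 hlane hbit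
    rw [testBit_lane] at hy₀
    refine ⟨((i : ZMod n₁), y₀), ?_, ?_⟩
    · show M.testBit ((i : ZMod n₁).val * E₂.g.n + E₂.enc y₀) = true
      rw [ZMod.val_cast_of_lt hin]; exact hy₀
    · refine Prod.ext ?_ (by simpa using hzy)
      show z.1 = (i : ZMod n₁) + t.1
      apply ZMod.val_injective n₁
      rw [ZMod.val_add, ZMod.val_cast_of_lt hin, hsum]

end Prod

end STPP211Neg

end Summit.MatrixMultiplication.OmegaCensus
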